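import Summits.HodgeConjecture.HodgeConjecture.Theorems.EndoscopicMiddleDegreeOrthogonalSplit
import Summits.HodgeConjecture.HodgeConjecture.Theorems.HeckePrymWeilWeilTwelvefoldsSqrtMinus7HodgeModelFacts
import Literature.AlgebraicGeometry.HodgeTheory.LefschetzOneOne
import Literature.AlgebraicGeometry.HodgeTheory.ComplexGysinCorrespondence
import Literature.AlgebraicGeometry.HodgeTheory.MotivatedClassesProofs
import Literature.AlgebraicGeometry.HodgeTheory.SupportedHodgeClassDescent
import Literature.AlgebraicGeometry.HodgeTheory.MotivatedClassesAlgebraic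
import Literature.AlgebraicTopology.SingularHomology.GysinMapSupportProofs
import Literature.AlgebraicGeometry.Motives.SegreEmbedding
import Literature.AlgebraicGeometry.HodgeTheory.ComplexGysinRational
import Literature.AlgebraicTopology.SingularHomology.GysinTransposition
import Literature.AlgebraicGeometry.HodgeTheory.GysinHodgeClassLiftProofs
import Literature.AlgebraicGeometry.HodgeTheory.RationalClassesRingChange
import Literature.AlgebraicGeometry.HodgeTheory.HodgeTypeConjugation

/-!
# Crux `IsotypicMiddleClassesAlgebraic` (stmt-HodgeConjecture-14301) — line `IdeatorTwoSketch`
(idea hodge-index-left-inverse, "Line B"), lead's skeleton, gen 1 (2026-08-16) — SELF-CONTAINED RENDERING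

(This rendering restates the five LANDED engine theorems with `sorry` because the hub has not yet
built their modules; the canonical skeleton imports them. Everything else is identical.)

This is the gen-0 lead's RESHAPED skeleton (registered 2026-08-16T06:39Z, sha 84da177c…) rebuilt on
top of the LANDED engine: the five engine stubs are no longer sorries but IMPORTS of accepted
`Theorems/` files —

* `stub_topGysinInjective` (p86978) — top-degree Gysin push-forward is injective;
* `stub_transposeAlgebraic` (p87590) — cylinder classes `ᵗΦ y = pr_{X*}(pr_F^* y ∪ Φ)` of divisor
  classes are algebraic (given the route support `CupProductAlgebraic`);
* `stub_inversion` (p87793) — relative BFNP (6.1): a rational Hodge `(n,n)`-class cup-orthogonal to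
  every rational Hodge class orthogonal to a set `S` of algebraic classes is algebraic (given
  Grothendieck coniveau + the Kähler package on `X`);
* `stub_corrActionAlgebraic` (p88732) — `P` preserves algebraic classes (given `CupProductAlgebraic`);
* `stub_kernel` (p88780) — a rational Hodge class orthogonal to all cylinder classes is killed by the
  incidence map `Φ_*` (adjunction + non-degeneracy of `∪` on `Hdg¹(F)`).

What is LEFT as `sorry` is exactly the residue of the line:

* `stub_classicalFacts` — four undischarged Literature NAMED FACTS (multiplicative de Rham theorem
  `exists_deRhamIsoFamily`, `Grothendieck1969_supportedClasses_le_hodgeConiveau`, the Kähler package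
  `hardLefschetz_hodgeRiemann`, `lefschetzOneOne_rational`): literature-prover debt, not crux content;
* `stub_sweep` (kernel form) / `stub_sweepProjected` (P-projected form) / `stub_sweepPointwise`
  (gen-1 reshape: P-projected, family chosen after the fixed class) — EXISTENCE of one algebraic
  family `Φ` on `F ⊗ X` (`F` a smooth projective surface) whose cylinder classes (resp. their
  `P`-projections) detect every (resp. the given) rational `P`-fixed class through the cup pairing.

VERDICT recorded with this file (see `Lines/IdeatorTwoSketch.dead.md`): granted the engine, each
existence stub is EQUIVALENT to the crux — every algebraic middle class `a` is itself a cylinder class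
(`Φ := pr_F^* y₀ ∪ pr_X^* a` on any surface `F` with a divisor class `y₀`, `y₀ · y₀ ≠ 0`, gives
`ᵗΦ(y₀) = (y₀ · y₀) a`), so "the fixed classes are detected by / spanned by cylinder classes" says no
less than "the fixed classes are spanned by algebraic classes", which is the crux
(`ker (P − 1) ≤ algebraicClasses`, Disproof F3(d)). KERNEL-CHECKED for the weakest form:
`Theorems.sweepProjected_pointwise_of_isotypicMiddleClassesAlgebraic` (lead gen 1, sorry-free, axioms
{propext, Classical.choice, Quot.sound}) proves crux ⟹ `stub_sweepPointwise` with `F = ℙ²`. The line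
therefore has no reduction power beyond its (landed) engine; it is dead as a LINE, the crux is
untouched (HC ⟹ crux, `Negative/NoKillShortOfHC`).

Compositions: `isotypicMiddleClassesAlgebraic_of_lineB` (kernel form),
`isotypicMiddleClassesAlgebraic_of_lineB_projected` (projected form) and
`isotypicMiddleClassesAlgebraic_of_lineB_pointwise` (pointwise form) conclude
`Summit.HodgeConjecture.HodgeConjecture.Theses.EndoscopicMiddleDegree.IsotypicMiddleClassesAlgebraic`
BY NAME from the stubs, the imported engine and the route support item `CupProductAlgebraic`
(stmt-HodgeConjecture-14350, hypothesis `h9`, as in gen 0).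
-/

noncomputable section

set_option linter.dupNamespace false

open CategoryTheory MonoidalCategory CartesianMonoidalCategory
open Literature.AlgebraicGeometry Literature.AlgebraicGeometry.Motives
open Literature.AlgebraicGeometry.HodgeTheory Literature.AlgebraicGeometry.ShimuraVarieties
open Literature.AlgebraicTopology.SingularHomology
open scoped Manifold

namespace Summit.HodgeConjecture.HodgeConjecture.Cruxes.IsotypicMiddleClassesAlgebraic.Lines.IdeatorTwoSketchSC

open Summit.HodgeConjecture.HodgeConjecture.Theorems
open Summit.HodgeConjecture.HodgeConjecture.Theses

/-- Degree bookkeeping for the incidence map `Φ_* : H^{2n}(X) → H²(F)` (same statement as the private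
lemma of the stub files; proofs of a `Prop` are irrelevant, so all `complexGysin`/`corrAction` terms
below agree with the registered signatures definitionally). -/
theorem lineB_deg_incidence (m : ℕ) :
    2 * (m + 1) + 2 * (m + 2) = 2 * 1 + 2 * (2 * (m + 1)) := by ring

/-- Degree bookkeeping for the transpose (cylinder) map `ᵗΦ : H²(F) → H^{2n}(X)`. -/
theorem lineB_deg_transpose (m : ℕ) :
    2 * (1 + (m + 2)) + 2 * (2 * (m + 1)) = 2 * (m + 1) + 2 * (2 + 2 * (m + 1)) := by ring


/-! ### The ENGINE — LANDED in `Theorems/` (p86978, p87590, p87793, p88732, p88780); restated here with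
`sorry` ONLY because the hub has not yet built those five modules (farm: `remote:stale:unbuilt`), so
that this rendering elaborates stand-alone. Signatures are verbatim the accepted ones; the canonical
skeleton `Lines/IdeatorTwoSketch.lean` IMPORTS them instead. -/

/-- ENGINE, LANDED p86978 (`Theorems.stub_topGysinInjective`): the top-degree Gysin push-forward is
injective. Restated verbatim (module not yet built on the hub). -/
theorem stub_topGysinInjective (μ : OrientationFamily) (hμ : μ.HasPoincareDuality)
    {d e : ℕ} {Y Z : SchemeOver ℂ} (hY : IsSmoothProjective d Y) (hZ : IsSmoothProjective e Z)
    (f : Y ⟶ Z) {a b : ℕ} (hab : a + 2 * e = b + 2 * d) (ha : a = 2 * d) :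
    Function.Injective (complexGysin μ hY hZ f hab) := by
  sorry

/-- ENGINE, LANDED p87590 (`Theorems.stub_transposeAlgebraic`): cylinder classes of divisor classes
are algebraic, given `CupProductAlgebraic`. Restated verbatim (module not yet built on the hub). -/
theorem stub_transposeAlgebraic (h9 : Theses.EndoscopicMiddleDegree.CupProductAlgebraic)
    (μ : OrientationFamily) (hμ : μ.HasPoincareDuality) (m : ℕ) (X : SchemeOver ℂ)
    (hX : IsSmoothProjective (2 * (m + 1)) X) (F : SchemeOver ℂ) (hF : IsSmoothProjective 2 F)
    (Φ : complexBetti (F ⊗ X) (2 * (m + 2))) (hΦ : Φ ∈ algebraicClasses (F ⊗ X) (m + 2))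
    (y : complexBetti F (2 * 1)) (hy : y ∈ algebraicClasses F 1) :
    complexGysin μ (IsSmoothProjective.tensor_holds hF hX) hX (snd F X) (lineB_deg_transpose m)
      (cupProduct (two_mul_add_two_mul 1 (m + 2)) (complexBetti.map (fst F X) (2 * 1) y) Φ) ∈
      algebraicClasses X (m + 1) := by
  sorry

/-- ENGINE, LANDED p87793 (`Theorems.stub_inversion`): the inversion lemma (relative BFNP (6.1)).
Restated verbatim (module not yet built on the hub). -/
theorem stub_inversion (hG : Grothendieck1969_supportedClasses_le_hodgeConiveau)
    (m : ℕ) (X : SchemeOver ℂ) (hX : IsSmoothProjective (2 * (m + 1)) X)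
    (hK : hardLefschetz_hodgeRiemann (2 * (m + 1)) X)
    (S : Set (complexBetti X (2 * (m + 1)))) (hS : S ⊆ algebraicClasses X (m + 1))
    (h : complexBetti X (2 * (m + 1))) (hhQ : IsRationalClass h)
    (hhT : IsOfHodgeType (2 * (m + 1)) X (2 * (m + 1)) (m + 1) (m + 1) h)
    (horth : ∀ k : complexBetti X (2 * (m + 1)), IsRationalClass k →
      IsOfHodgeType (2 * (m + 1)) X (2 * (m + 1)) (m + 1) (m + 1) k →
      (∀ s ∈ S, cupProduct (two_mul_add_two_mul (m + 1) (m + 1)) k s = 0) →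
      cupProduct (two_mul_add_two_mul (m + 1) (m + 1)) h k = 0) :
    h ∈ algebraicClasses X (m + 1) := by
  sorry

/-- ENGINE, LANDED p88732 (`Theorems.stub_corrActionAlgebraic`): `P` preserves algebraic classes,
given `CupProductAlgebraic`. Restated verbatim (module not yet built on the hub). -/
theorem stub_corrActionAlgebraic (h9 : Theses.EndoscopicMiddleDegree.CupProductAlgebraic)
    (μ : OrientationFamily) (hμ : μ.HasPoincareDuality) (m : ℕ) (X : SchemeOver ℂ)
    (hX : IsSmoothProjective (2 * (m + 1)) X)
    (γ : complexBetti (X ⊗ X) (2 * (2 * (m + 1)))) (hγ : γ ∈ algebraicClasses (X ⊗ X) (2 * (m + 1)))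
    (a : complexBetti X (2 * (m + 1))) (ha : a ∈ algebraicClasses X (m + 1)) :
    corrAction μ hX hX
      (rfl : 2 * (m + 1) + 2 * (2 * (m + 1)) = 2 * (m + 1) + 2 * (2 * (m + 1))) γ a ∈
      algebraicClasses X (m + 1) := by
  sorry

/-- ENGINE, LANDED p88780 (`Theorems.stub_kernel`): a rational Hodge class orthogonal to all
cylinder classes is killed by the incidence map. Restated verbatim (module not yet built). -/
theorem stub_kernel (hM : ∀ (d : ℕ) (Y : SchemeOver ℂ), nonempty_hodgeModel d Y)
    (hdR : ∀ (E : Type) [NormedAddCommGroup E] [NormedSpace ℂ E] [FiniteDimensional ℂ E],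
      Literature.NumberTheory.Transcendental.exists_deRhamIsoFamily 𝓘(ℝ, E))
    (hG : Grothendieck1969_supportedClasses_le_hodgeConiveau)
    (μ : OrientationFamily) (hμ : μ.HasPoincareDuality) (m : ℕ) (X : SchemeOver ℂ)
    (hX : IsSmoothProjective (2 * (m + 1)) X) (F : SchemeOver ℂ) (hF : IsSmoothProjective 2 F)
    (hK : hardLefschetz_hodgeRiemann 2 F)
    (hfst : ∀ {a b : ℕ} (hab : a + 2 * 2 = b + 2 * (2 + 2 * (m + 1))), a = 2 * (2 + 2 * (m + 1)) →
      Function.Injective (complexGysin μ (IsSmoothProjective.tensor_holds hF hX) hF (fst F X) hab))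
    (hsnd : ∀ {a b : ℕ} (hab : a + 2 * (2 * (m + 1)) = b + 2 * (2 + 2 * (m + 1))),
      a = 2 * (2 + 2 * (m + 1)) →
      Function.Injective (complexGysin μ (IsSmoothProjective.tensor_holds hF hX) hX (snd F X) hab))
    (Φ : complexBetti (F ⊗ X) (2 * (m + 2))) (hΦ : Φ ∈ algebraicClasses (F ⊗ X) (m + 2))
    (k : complexBetti X (2 * (m + 1))) (hkQ : IsRationalClass k)
    (hkT : IsOfHodgeType (2 * (m + 1)) X (2 * (m + 1)) (m + 1) (m + 1) k)
    (horth : ∀ y : complexBetti F (2 * 1), IsRationalClass y → IsOfHodgeType 2 F (2 * 1) 1 1 y →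
      cupProduct (two_mul_add_two_mul (m + 1) (m + 1)) k
        (complexGysin μ (IsSmoothProjective.tensor_holds hF hX) hX (snd F X) (lineB_deg_transpose m)
          (cupProduct (two_mul_add_two_mul 1 (m + 2)) (complexBetti.map (fst F X) (2 * 1) y) Φ)) = 0) :
    corrAction μ hF hX (lineB_deg_incidence m) Φ k = 0 := by
  sorry

/-! ### The two residual stubs (plus the named-fact stub) -/

/-- STUB `stub_classicalFacts` (registered signature verbatim): four Literature NAMED FACTS, none
discharged in the tree — (1) de Rham's theorem as a natural multiplicative normalised family
(Warner Thm. 5.36/5.45), (2) Grothendieck 1969: supported classes have the expected Hodge coniveau,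
(3) the Kähler package (hard Lefschetz + Hodge–Riemann) for every smooth projective `Y`,
(4) Lefschetz' theorem on `(1,1)`-classes, rational form. Literature-prover debt; blocks nothing
crux-specific. -/
theorem stub_classicalFacts :
    (∀ (E : Type) [NormedAddCommGroup E] [NormedSpace ℂ E] [FiniteDimensional ℂ E],
        Literature.NumberTheory.Transcendental.exists_deRhamIsoFamily 𝓘(ℝ, E)) ∧
      Grothendieck1969_supportedClasses_le_hodgeConiveau ∧
      (∀ (d : ℕ) (Y : SchemeOver ℂ), hardLefschetz_hodgeRiemann d Y) ∧ lefschetzOneOne_rational := by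
  sorry

/-- STUB `stub_sweep` (registered signature verbatim; the line's residue, KERNEL FORM): for the data
of the crux there is a smooth projective surface `F` and an ALGEBRAIC class `Φ` of codimension `m + 2`
on `F ⊗ X` such that every rational `P`-fixed class `c` is cup-orthogonal to every rational Hodge
`(n,n)`-class `k` killed by the incidence map `Φ_* = corrAction μ hF hX _ Φ`. Granted the engine this
is EQUIVALENT to the crux (module docstring): crux-sized, not closable by any prover short of HC on
the piece. -/
theorem stub_sweep (μ : OrientationFamily) (hμ : μ.HasPoincareDuality) (m : ℕ) (X : SchemeOver ℂ)
    (D : UnitaryBallQuotientDatum (2 * (m + 1)) X) (h1 : 1 ≤ m) (h2 : m ≤ 2)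
    (γ : complexBetti (X ⊗ X) (2 * (2 * (m + 1))))
    (hγ : γ ∈ algebraicClasses (X ⊗ X) (2 * (m + 1)))
    (hPrat : ∀ β, IsRationalClass β → IsRationalClass (corrAction μ D.isSmoothProjective
      D.isSmoothProjective
      (rfl : 2 * (m + 1) + 2 * (2 * (m + 1)) = 2 * (m + 1) + 2 * (2 * (m + 1))) γ β))
    (hPhdg : ∀ β, IsOfHodgeType (2 * (m + 1)) X (2 * (m + 1)) (m + 1) (m + 1)
      (corrAction μ D.isSmoothProjective D.isSmoothProjective
        (rfl : 2 * (m + 1) + 2 * (2 * (m + 1)) = 2 * (m + 1) + 2 * (2 * (m + 1))) γ β)) :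
    ∃ (F : SchemeOver ℂ) (hF : IsSmoothProjective 2 F) (Φ : complexBetti (F ⊗ X) (2 * (m + 2)))
      (_ : Φ ∈ algebraicClasses (F ⊗ X) (m + 2)),
      ∀ c : complexBetti X (2 * (m + 1)), IsRationalClass c →
        corrAction μ D.isSmoothProjective D.isSmoothProjective
          (rfl : 2 * (m + 1) + 2 * (2 * (m + 1)) = 2 * (m + 1) + 2 * (2 * (m + 1))) γ c = c →
        ∀ k : complexBetti X (2 * (m + 1)), IsRationalClass k →
          IsOfHodgeType (2 * (m + 1)) X (2 * (m + 1)) (m + 1) (m + 1) k →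
          corrAction μ hF D.isSmoothProjective (lineB_deg_incidence m) Φ k = 0 →
          cupProduct (two_mul_add_two_mul (m + 1) (m + 1)) c k = 0 := by
  sorry

/-- STUB `stub_sweepProjected` (registered signature verbatim; the line's residue, P-PROJECTED FORM,
the weakest useful one): as `stub_sweep`, but `c` need only be orthogonal to the rational Hodge
classes `k` which are orthogonal to the `P`-PROJECTIONS `P(ᵗΦ y)` of the cylinder classes of all
rational `(1,1)`-classes `y` on `F`. For a Hecke-simple piece with `P` its idempotent this is ONE
divisor class `y` on ONE family with `P(ᵗΦ y) ≠ 0`. Granted the engine, EQUIVALENT to the crux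
(module docstring). -/
theorem stub_sweepProjected (μ : OrientationFamily) (hμ : μ.HasPoincareDuality) (m : ℕ)
    (X : SchemeOver ℂ) (D : UnitaryBallQuotientDatum (2 * (m + 1)) X) (h1 : 1 ≤ m) (h2 : m ≤ 2)
    (γ : complexBetti (X ⊗ X) (2 * (2 * (m + 1))))
    (hγ : γ ∈ algebraicClasses (X ⊗ X) (2 * (m + 1)))
    (hPrat : ∀ β, IsRationalClass β → IsRationalClass (corrAction μ D.isSmoothProjective
      D.isSmoothProjective
      (rfl : 2 * (m + 1) + 2 * (2 * (m + 1)) = 2 * (m + 1) + 2 * (2 * (m + 1))) γ β))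
    (hPhdg : ∀ β, IsOfHodgeType (2 * (m + 1)) X (2 * (m + 1)) (m + 1) (m + 1)
      (corrAction μ D.isSmoothProjective D.isSmoothProjective
        (rfl : 2 * (m + 1) + 2 * (2 * (m + 1)) = 2 * (m + 1) + 2 * (2 * (m + 1))) γ β)) :
    ∃ (F : SchemeOver ℂ) (hF : IsSmoothProjective 2 F) (Φ : complexBetti (F ⊗ X) (2 * (m + 2)))
      (_ : Φ ∈ algebraicClasses (F ⊗ X) (m + 2)),
      ∀ c : complexBetti X (2 * (m + 1)), IsRationalClass c →
        corrAction μ D.isSmoothProjective D.isSmoothProjective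
          (rfl : 2 * (m + 1) + 2 * (2 * (m + 1)) = 2 * (m + 1) + 2 * (2 * (m + 1))) γ c = c →
        ∀ k : complexBetti X (2 * (m + 1)), IsRationalClass k →
          IsOfHodgeType (2 * (m + 1)) X (2 * (m + 1)) (m + 1) (m + 1) k →
          (∀ y : complexBetti F (2 * 1), IsRationalClass y → IsOfHodgeType 2 F (2 * 1) 1 1 y →
            cupProduct (two_mul_add_two_mul (m + 1) (m + 1)) k
              (corrAction μ D.isSmoothProjective D.isSmoothProjective
                (rfl : 2 * (m + 1) + 2 * (2 * (m + 1)) = 2 * (m + 1) + 2 * (2 * (m + 1))) γ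
                (complexGysin μ (IsSmoothProjective.tensor_holds hF D.isSmoothProjective)
                  D.isSmoothProjective (snd F X) (lineB_deg_transpose m)
                  (cupProduct (two_mul_add_two_mul 1 (m + 2))
                    (complexBetti.map (fst F X) (2 * 1) y) Φ))) = 0) →
          cupProduct (two_mul_add_two_mul (m + 1) (m + 1)) c k = 0 := by
  sorry

/-- STUB `stub_sweepPointwise` (gen-1 reshape, the WEAKEST form of the residue: the family may depend on
the fixed class `c`): for every rational `P`-fixed `c` there is a smooth projective surface `F` and an
algebraic `Φ` on `F ⊗ X` such that every rational Hodge `(n,n)`-class `k` orthogonal to all `P(ᵗΦ y)`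
(`y` rational `(1,1)` on `F`) is orthogonal to `c`. It still closes the crux through the engine
(`isotypicMiddleClassesAlgebraic_of_lineB_pointwise`), and the crux IMPLIES it — PROVED, sorry-free:
`Theorems.sweepProjected_pointwise_of_isotypicMiddleClassesAlgebraic` (cylinder remark, `F = ℙ²`,
`Φ = pr_F^*[H] ∪ pr_X^* c`, `ᵗΦ[H] = ε • c`, `ε ≠ 0`). So this stub, and a fortiori `stub_sweepProjected`
and `stub_sweep`, are EQUIVALENT to the crux granted the engine: the line is circular (dead as a line). -/
theorem stub_sweepPointwise (μ : OrientationFamily) (hμ : μ.HasPoincareDuality) (m : ℕ)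
    (X : SchemeOver ℂ) (D : UnitaryBallQuotientDatum (2 * (m + 1)) X) (h1 : 1 ≤ m) (h2 : m ≤ 2)
    (γ : complexBetti (X ⊗ X) (2 * (2 * (m + 1))))
    (hγ : γ ∈ algebraicClasses (X ⊗ X) (2 * (m + 1)))
    (hPrat : ∀ β, IsRationalClass β → IsRationalClass (corrAction μ D.isSmoothProjective
      D.isSmoothProjective
      (rfl : 2 * (m + 1) + 2 * (2 * (m + 1)) = 2 * (m + 1) + 2 * (2 * (m + 1))) γ β))
    (hPhdg : ∀ β, IsOfHodgeType (2 * (m + 1)) X (2 * (m + 1)) (m + 1) (m + 1)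
      (corrAction μ D.isSmoothProjective D.isSmoothProjective
        (rfl : 2 * (m + 1) + 2 * (2 * (m + 1)) = 2 * (m + 1) + 2 * (2 * (m + 1))) γ β))
    (c : complexBetti X (2 * (m + 1))) (hc : IsRationalClass c)
    (hPc : corrAction μ D.isSmoothProjective D.isSmoothProjective
      (rfl : 2 * (m + 1) + 2 * (2 * (m + 1)) = 2 * (m + 1) + 2 * (2 * (m + 1))) γ c = c) :
    ∃ (F : SchemeOver ℂ) (hF : IsSmoothProjective 2 F) (Φ : complexBetti (F ⊗ X) (2 * (m + 2)))
      (_ : Φ ∈ algebraicClasses (F ⊗ X) (m + 2)),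
      ∀ k : complexBetti X (2 * (m + 1)), IsRationalClass k →
        IsOfHodgeType (2 * (m + 1)) X (2 * (m + 1)) (m + 1) (m + 1) k →
        (∀ y : complexBetti F (2 * 1), IsRationalClass y → IsOfHodgeType 2 F (2 * 1) 1 1 y →
          cupProduct (two_mul_add_two_mul (m + 1) (m + 1)) k
            (corrAction μ D.isSmoothProjective D.isSmoothProjective
              (rfl : 2 * (m + 1) + 2 * (2 * (m + 1)) = 2 * (m + 1) + 2 * (2 * (m + 1))) γ
              (complexGysin μ (IsSmoothProjective.tensor_holds hF D.isSmoothProjective)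
                D.isSmoothProjective (snd F X) (lineB_deg_transpose m)
                (cupProduct (two_mul_add_two_mul 1 (m + 2))
                  (complexBetti.map (fst F X) (2 * 1) y) Φ))) = 0) →
        cupProduct (two_mul_add_two_mul (m + 1) (m + 1)) c k = 0 := by
  sorry

/-- STUB `stub_sweepCircular` (gen-1, the line's SOUNDNESS CHECK, converse direction): the crux IMPLIES
the pointwise P-projected SWEEP residue `stub_sweepPointwise` — i.e. the residue of Line B is no weaker
than the crux it was meant to reduce (cylinder remark: `F = ℙ²`, `Φ = pr_F^*[H] ∪ pr_X^* c`,
`ᵗΦ[H] = ε • c` with `ε ≠ 0`). PROVED, sorry-free, as `Theorems.stub_sweepCircular`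
(`Theorems/EndoscopicMiddleDegreeIsotypicMiddleClassesAlgebraicSweepCircular.lean`, lead gen 1);
restated here with `sorry` only so that the registered signature is this one verbatim (the canonical
skeleton imports the landed theorem once the hub has built it). -/
theorem stub_sweepCircular
    (h9 : Theses.EndoscopicMiddleDegree.CupProductAlgebraic)
    (hG : Grothendieck1969_supportedClasses_le_hodgeConiveau)
    (hK : ∀ (d : ℕ) (Y : SchemeOver ℂ), hardLefschetz_hodgeRiemann d Y)
    (hcrux : Theses.EndoscopicMiddleDegree.IsotypicMiddleClassesAlgebraic)
    (μ : OrientationFamily) (hμ : μ.HasPoincareDuality) (m : ℕ) (X : SchemeOver ℂ)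
    (D : UnitaryBallQuotientDatum (2 * (m + 1)) X) (h1 : 1 ≤ m) (h2 : m ≤ 2)
    (γ : complexBetti (X ⊗ X) (2 * (2 * (m + 1))))
    (hγ : γ ∈ algebraicClasses (X ⊗ X) (2 * (m + 1)))
    (hPrat : ∀ β, IsRationalClass β → IsRationalClass (corrAction μ D.isSmoothProjective
      D.isSmoothProjective
      (rfl : 2 * (m + 1) + 2 * (2 * (m + 1)) = 2 * (m + 1) + 2 * (2 * (m + 1))) γ β))
    (hPhdg : ∀ β, IsOfHodgeType (2 * (m + 1)) X (2 * (m + 1)) (m + 1) (m + 1)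
      (corrAction μ D.isSmoothProjective D.isSmoothProjective
        (rfl : 2 * (m + 1) + 2 * (2 * (m + 1)) = 2 * (m + 1) + 2 * (2 * (m + 1))) γ β))
    (c : complexBetti X (2 * (m + 1))) (hc : IsRationalClass c)
    (hPc : corrAction μ D.isSmoothProjective D.isSmoothProjective
      (rfl : 2 * (m + 1) + 2 * (2 * (m + 1)) = 2 * (m + 1) + 2 * (2 * (m + 1))) γ c = c) :
    ∃ (F : SchemeOver ℂ) (hF : IsSmoothProjective 2 F) (Φ : complexBetti (F ⊗ X) (2 * (m + 2)))
      (_ : Φ ∈ algebraicClasses (F ⊗ X) (m + 2)),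
      ∀ k : complexBetti X (2 * (m + 1)), IsRationalClass k →
        IsOfHodgeType (2 * (m + 1)) X (2 * (m + 1)) (m + 1) (m + 1) k →
        (∀ y : complexBetti F (2 * 1), IsRationalClass y → IsOfHodgeType 2 F (2 * 1) 1 1 y →
          cupProduct (two_mul_add_two_mul (m + 1) (m + 1)) k
            (corrAction μ D.isSmoothProjective D.isSmoothProjective
              (rfl : 2 * (m + 1) + 2 * (2 * (m + 1)) = 2 * (m + 1) + 2 * (2 * (m + 1))) γ
              (complexGysin μ (IsSmoothProjective.tensor_holds hF D.isSmoothProjective)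
                D.isSmoothProjective (snd F X) (lineB_deg_transpose m)
                (cupProduct (two_mul_add_two_mul 1 (m + 2))
                  (complexBetti.map (fst F X) (2 * 1) y) Φ))) = 0) →
        cupProduct (two_mul_add_two_mul (m + 1) (m + 1)) c k = 0 := by
  sorry

/-! ### Compositions: the stubs + the landed engine conclude the crux BY NAME -/

/-- **Line B, kernel form.** `CupProductAlgebraic` (route support stmt-HodgeConjecture-14350) +
`stub_classicalFacts` + `stub_sweep` + the LANDED engine (`stub_transposeAlgebraic`,
`stub_inversion`, `stub_kernel`, `stub_topGysinInjective`) ⟹ the crux. Proof: for a rational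
`P`-fixed `c` (Hodge `(n,n)` since `c = P c`), apply the inversion lemma with the detecting set
`S = {ᵗΦ y : y rational (1,1) on F}` (algebraic by Lefschetz `(1,1)` + transpose); a rational Hodge
`k ⊥ S` is killed by `Φ_*` (`stub_kernel`, fed with Hodge models — a theorem,
`nonempty_hodgeModel_all_holds` — and the top-degree injectivities), hence `c ∪ k = 0` by SWEEP. -/
theorem isotypicMiddleClassesAlgebraic_of_lineB (h9 : EndoscopicMiddleDegree.CupProductAlgebraic) :
    EndoscopicMiddleDegree.IsotypicMiddleClassesAlgebraic := by
  intro μ hμ m X D h1 h2 γ hγ P hPrat hPhdg c hc hPc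
  obtain ⟨hdR, hG, hK, hL⟩ := stub_classicalFacts
  have hX : IsSmoothProjective (2 * (m + 1)) X := D.isSmoothProjective
  have hPrat' : ∀ β, IsRationalClass β → IsRationalClass (corrAction μ D.isSmoothProjective
      D.isSmoothProjective
      (rfl : 2 * (m + 1) + 2 * (2 * (m + 1)) = 2 * (m + 1) + 2 * (2 * (m + 1))) γ β) := hPrat
  have hPhdg' : ∀ β, IsOfHodgeType (2 * (m + 1)) X (2 * (m + 1)) (m + 1) (m + 1)
      (corrAction μ D.isSmoothProjective D.isSmoothProjective
        (rfl : 2 * (m + 1) + 2 * (2 * (m + 1)) = 2 * (m + 1) + 2 * (2 * (m + 1))) γ β) := hPhdg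
  have hPc' : corrAction μ D.isSmoothProjective D.isSmoothProjective
      (rfl : 2 * (m + 1) + 2 * (2 * (m + 1)) = 2 * (m + 1) + 2 * (2 * (m + 1))) γ c = c := hPc
  have hcT : IsOfHodgeType (2 * (m + 1)) X (2 * (m + 1)) (m + 1) (m + 1) c := by
    have h := hPhdg' c
    rwa [hPc'] at h
  obtain ⟨F, hF, Φ, hΦ, H⟩ := stub_sweep μ hμ m X D h1 h2 γ hγ hPrat' hPhdg'
  set S : Set (complexBetti X (2 * (m + 1))) :=
    {s | ∃ y : complexBetti F (2 * 1), IsRationalClass y ∧ IsOfHodgeType 2 F (2 * 1) 1 1 y ∧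
      s = complexGysin μ (IsSmoothProjective.tensor_holds hF hX) hX (snd F X) (lineB_deg_transpose m)
        (cupProduct (two_mul_add_two_mul 1 (m + 2)) (complexBetti.map (fst F X) (2 * 1) y) Φ)}
    with hSdef
  have hS : S ⊆ algebraicClasses X (m + 1) := by
    rintro s ⟨y, hyQ, hyT, rfl⟩
    exact stub_transposeAlgebraic h9 μ hμ m X hX F hF Φ hΦ y (hL hF y hyQ hyT)
  refine stub_inversion hG m X hX (hK _ X) S hS c hc hcT ?_
  intro k hkQ hkT hkS
  refine H c hc hPc' k hkQ hkT ?_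
  exact stub_kernel
    Summit.HodgeConjecture.HodgeConjecture.Theorems.WeilTwelvefoldsSqrtMinus7.AmnesicSecantSheaves.nonempty_hodgeModel_all_holds
    hdR hG μ hμ m X hX F hF (hK 2 F)
    (fun hab ha ↦ stub_topGysinInjective μ hμ (IsSmoothProjective.tensor_holds hF hX) hF (fst F X)
      hab ha)
    (fun hab ha ↦ stub_topGysinInjective μ hμ (IsSmoothProjective.tensor_holds hF hX) hX (snd F X)
      hab ha)
    Φ hΦ k hkQ hkT (fun y hyQ hyT ↦ hkS _ ⟨y, hyQ, hyT, rfl⟩)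

/-- **Line B, P-projected form.** `CupProductAlgebraic` + `stub_classicalFacts` +
`stub_sweepProjected` + the LANDED engine (`stub_transposeAlgebraic`, `stub_corrActionAlgebraic`,
`stub_inversion`) ⟹ the crux: inversion lemma with the detecting set
`S = {P(ᵗΦ y) : y rational (1,1) on F} ⊆ algebraicClasses` (Lefschetz `(1,1)`, transpose, `P`
preserves algebraic classes). -/
theorem isotypicMiddleClassesAlgebraic_of_lineB_projected
    (h9 : EndoscopicMiddleDegree.CupProductAlgebraic) :
    EndoscopicMiddleDegree.IsotypicMiddleClassesAlgebraic := by
  intro μ hμ m X D h1 h2 γ hγ P hPrat hPhdg c hc hPc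
  obtain ⟨-, hG, hK, hL⟩ := stub_classicalFacts
  have hX : IsSmoothProjective (2 * (m + 1)) X := D.isSmoothProjective
  have hPrat' : ∀ β, IsRationalClass β → IsRationalClass (corrAction μ D.isSmoothProjective
      D.isSmoothProjective
      (rfl : 2 * (m + 1) + 2 * (2 * (m + 1)) = 2 * (m + 1) + 2 * (2 * (m + 1))) γ β) := hPrat
  have hPhdg' : ∀ β, IsOfHodgeType (2 * (m + 1)) X (2 * (m + 1)) (m + 1) (m + 1)
      (corrAction μ D.isSmoothProjective D.isSmoothProjective
        (rfl : 2 * (m + 1) + 2 * (2 * (m + 1)) = 2 * (m + 1) + 2 * (2 * (m + 1))) γ β) := hPhdg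
  have hPc' : corrAction μ D.isSmoothProjective D.isSmoothProjective
      (rfl : 2 * (m + 1) + 2 * (2 * (m + 1)) = 2 * (m + 1) + 2 * (2 * (m + 1))) γ c = c := hPc
  have hcT : IsOfHodgeType (2 * (m + 1)) X (2 * (m + 1)) (m + 1) (m + 1) c := by
    have h := hPhdg' c
    rwa [hPc'] at h
  obtain ⟨F, hF, Φ, hΦ, H⟩ := stub_sweepProjected μ hμ m X D h1 h2 γ hγ hPrat' hPhdg'
  set S : Set (complexBetti X (2 * (m + 1))) :=
    {s | ∃ y : complexBetti F (2 * 1), IsRationalClass y ∧ IsOfHodgeType 2 F (2 * 1) 1 1 y ∧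
      s = corrAction μ D.isSmoothProjective D.isSmoothProjective
        (rfl : 2 * (m + 1) + 2 * (2 * (m + 1)) = 2 * (m + 1) + 2 * (2 * (m + 1))) γ
        (complexGysin μ (IsSmoothProjective.tensor_holds hF D.isSmoothProjective)
          D.isSmoothProjective (snd F X) (lineB_deg_transpose m)
          (cupProduct (two_mul_add_two_mul 1 (m + 2)) (complexBetti.map (fst F X) (2 * 1) y) Φ))}
    with hSdef
  have hS : S ⊆ algebraicClasses X (m + 1) := by
    rintro s ⟨y, hyQ, hyT, rfl⟩
    exact stub_corrActionAlgebraic h9 μ hμ m X hX γ hγ _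
      (stub_transposeAlgebraic h9 μ hμ m X hX F hF Φ hΦ y (hL hF y hyQ hyT))
  refine stub_inversion hG m X hX (hK _ X) S hS c hc hcT ?_
  intro k hkQ hkT hkS
  exact H c hc hPc' k hkQ hkT (fun y hyQ hyT ↦ hkS _ ⟨y, hyQ, hyT, rfl⟩)

/-- **Line B, pointwise P-projected form** (gen-1 reshape): `CupProductAlgebraic` +
`stub_classicalFacts` + `stub_sweepPointwise` + the LANDED engine ⟹ the crux — the same proof as the
projected form, the family being chosen AFTER the fixed class `c`. Together with
`Theorems.sweepProjected_pointwise_of_isotypicMiddleClassesAlgebraic` (crux ⟹ `stub_sweepPointwise`,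
proved) this exhibits the residue of Line B as EQUIVALENT to the crux modulo the engine's inputs. -/
theorem isotypicMiddleClassesAlgebraic_of_lineB_pointwise
    (h9 : EndoscopicMiddleDegree.CupProductAlgebraic) :
    EndoscopicMiddleDegree.IsotypicMiddleClassesAlgebraic := by
  intro μ hμ m X D h1 h2 γ hγ P hPrat hPhdg c hc hPc
  obtain ⟨-, hG, hK, hL⟩ := stub_classicalFacts
  have hX : IsSmoothProjective (2 * (m + 1)) X := D.isSmoothProjective
  have hPrat' : ∀ β, IsRationalClass β → IsRationalClass (corrAction μ D.isSmoothProjective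
      D.isSmoothProjective
      (rfl : 2 * (m + 1) + 2 * (2 * (m + 1)) = 2 * (m + 1) + 2 * (2 * (m + 1))) γ β) := hPrat
  have hPhdg' : ∀ β, IsOfHodgeType (2 * (m + 1)) X (2 * (m + 1)) (m + 1) (m + 1)
      (corrAction μ D.isSmoothProjective D.isSmoothProjective
        (rfl : 2 * (m + 1) + 2 * (2 * (m + 1)) = 2 * (m + 1) + 2 * (2 * (m + 1))) γ β) := hPhdg
  have hPc' : corrAction μ D.isSmoothProjective D.isSmoothProjective
      (rfl : 2 * (m + 1) + 2 * (2 * (m + 1)) = 2 * (m + 1) + 2 * (2 * (m + 1))) γ c = c := hPc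
  have hcT : IsOfHodgeType (2 * (m + 1)) X (2 * (m + 1)) (m + 1) (m + 1) c := by
    have h := hPhdg' c
    rwa [hPc'] at h
  obtain ⟨F, hF, Φ, hΦ, H⟩ := stub_sweepPointwise μ hμ m X D h1 h2 γ hγ hPrat' hPhdg' c hc hPc'
  set S : Set (complexBetti X (2 * (m + 1))) :=
    {s | ∃ y : complexBetti F (2 * 1), IsRationalClass y ∧ IsOfHodgeType 2 F (2 * 1) 1 1 y ∧
      s = corrAction μ D.isSmoothProjective D.isSmoothProjective
        (rfl : 2 * (m + 1) + 2 * (2 * (m + 1)) = 2 * (m + 1) + 2 * (2 * (m + 1))) γ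
        (complexGysin μ (IsSmoothProjective.tensor_holds hF D.isSmoothProjective)
          D.isSmoothProjective (snd F X) (lineB_deg_transpose m)
          (cupProduct (two_mul_add_two_mul 1 (m + 2)) (complexBetti.map (fst F X) (2 * 1) y) Φ))}
    with hSdef
  have hS : S ⊆ algebraicClasses X (m + 1) := by
    rintro s ⟨y, hyQ, hyT, rfl⟩
    exact stub_corrActionAlgebraic h9 μ hμ m X hX γ hγ _
      (stub_transposeAlgebraic h9 μ hμ m X hX F hF Φ hΦ y (hL hF y hyQ hyT))
  refine stub_inversion hG m X hX (hK _ X) S hS c hc hcT ?_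
  intro k hkQ hkT hkS
  exact H k hkQ hkT (fun y hyQ hyT ↦ hkS _ ⟨y, hyQ, hyT, rfl⟩)

end Summit.HodgeConjecture.HodgeConjecture.Cruxes.IsotypicMiddleClassesAlgebraic.Lines.IdeatorTwoSketchSC

end
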